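import Summits.BirchSwinnertonDyer.BirchSwinnertonDyer.Theorems.ErratumRoadFiveRest3ShaAnCertificate
import HarnessLib

/-!
# Route `ErratumRoadFive` (K2 at `p ≥ 5`) — objects the route posits (Defs): the `Ш_an`-CUT of the crux
# `RamNoErratumDataAtFive` (REST‴, item stmt-BirchSwinnertonDyer-19624) into a branch PROVED modulo the route's published inputs
# and the residual branch «`#Ш(E)_an` has positive `p`-adic valuation», with the lossless glue
# (cell `bsd-stepL`, owner seat `bsd-stepL-rest-p2` g4; `--supports stmt-BirchSwinnertonDyer-19624`; Theses-FREE — a route file may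
# import it; two `Prop` constants + glue theorems; no named fact, no `sorry`)

WHY (planner-facing). Modulo `PublishedInputsFive` + `JSWAnticyclotomicControlMult` the crux is EXACTLY the lower half
`ord_p #Ш(E)_an ≤ ord_p #Ш(E)` on its pairs (`Theorems/ErratumRoadFiveRest3Exact.lean`, p514964), and the lower half is free wherever
`ord_p #Ш(E)_an ≤ 0` (`Theorems/ErratumRoadFiveRest3ShaAnCertificate.lean`, p512402). Cutting REST‴ by that datum gives

* **branch (U) `Rest3ShaUnitBranchAtFive`** — REST‴ at the pairs carrying the datum `#Ш(E)_an = s ∈ ℚ`, `ord_p s ≤ 0`: a THEOREM modulo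
  {Gross–Zagier, Kolyvagin, Skinner 2016 Thm. C, GZK, modularity} + JSW17 Thm. 3.3.1-mult (`rest3ShaUnitBranchAtFive_of_thm331Mult`
  below — no data hypothesis left); census: ALL 703 204 REST‴ pairs `N < 5·10⁵` lie here (HOME/rest/SHA-CENSUS-REST3.md, two engines);
* **branch (D) `Rest3ShaDivisibleBranchAtFive`** — REST‴ at the pairs where `#Ш(E)_an`, whenever rational, has POSITIVE `p`-adic valuation
  (granted BSD: exactly the pairs with `Ш(E)[p] ≠ 0`): the genuine no-road residual of item 19624 — EMPTY below `5·10⁵`, non-empty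
  class-wide by BSD + Cohen–Lenstra–Delaunay heuristics, and reachable by no printed theorem (erratum road: needs a non-split ramified
  witness; Kolyvagin road: SZ14 Thm. 1.3 PRE, Locus-only, and it proves `M_∞ = 0`, i.e. again the `Ш`-trivial case at `p ∤ ∏c`).

So the planner may (a) `--split` 19624 into (U) + (D) with glue `rest3_of_shaBranches` (lossless: `rest3_iff_shaBranches`), (U) closing at
once modulo the two support items, or (b) DOWN 19624 to (D) inside `closes` via `rest3_of_rest3ShaDivisibleBranch_of_thm331Mult` (facts
= conjuncts 1, 2, 4, 6, 7 of `PublishedInputsFive` + item 19626). Either way K2's record then names its REST‴ content honestly: «the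
lower half of BSD(E,p) at the (ram) no-erratum pairs with `p ∣ #Ш(E)_an`». HONEST FRAMING: two `Prop` constants (restrictions of an OPEN
crux; nothing asserted) and glue; every bridge is CONDITIONAL on its displayed hypotheses; BSD is proved for no pair; no census word,
tier or label moves (T7).

References: [Miller2011LMS] Def. 1.1; [Castella2018Erratum] Thm. 1.1 (iii)–(iv); [JetchevSkinnerWan2017] Thm. 3.3.1, §7.4.1;
[Skinner2016PacificMC] Thm. C; [SkinnerZhang2014] Thm. 1.3; [Delaunay2001] (heuristics on `#Ш`; context only).
-/

set_option autoImplicit false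
-- the Theorems namespace of this sub repeats the summit name by design (D-0017 nested layout)
set_option linter.dupNamespace false

noncomputable section

open scoped Classical

namespace Summit.BirchSwinnertonDyer.BirchSwinnertonDyer.Theorems

open WeierstrassCurve NumberField Literature.NumberTheory.EllipticCurves
  Literature.NumberTheory.EllipticCurves.Rank1Residual
  Literature.NumberTheory.EllipticCurves.Rank1Residual.Typed
  Summit.BirchSwinnertonDyer.Rank1Residual Summit.BirchSwinnertonDyer.Rank1Residual.X11b

/-! ### §0 The two branches (route-posited objects; nothing asserted) -/

/-- [crux branch (U) of item 19624 `RamNoErratumDataAtFive`] **REST‴ on the (ram) no-erratum pairs CARRYING THE `Ш_an` DATUM**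
`#Ш(E)_an = s ∈ ℚ` with `ord_p s ≤ 0`: route p2's open input `P2OpenInputOnTreeAt W p` there. The (ram) and erratum clauses are item
19624's sub-expressions VERBATIM. A THEOREM modulo the published facts + JSW17 Thm. 3.3.1-mult (`rest3ShaUnitBranchAtFive_of_thm331Mult`);
all 703 204 REST‴ pairs with `N < 5·10⁵` lie in this branch (census of record, two engines). A `Prop` constant; nothing asserted.
[cite: Miller2011LMS, Def. 1.1 (the datum `#Ш_an`; nothing asserted)] [cite: Castella2018Erratum, Thm. 1.1 (iii)–(iv) (the excluded clauses)] -/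
@[conjecture]
def Rest3ShaUnitBranchAtFive : Prop :=
  ∀ (W : WeierstrassCurve ℚ) [W.IsElliptic] [W.IsGloballyMinimal] (p : ℕ) [Fact p.Prime],
    Literature.NumberTheory.EllipticCurves.Rank1Residual.Ram W p →
    ¬ ((∃ (q : ℕ) (_ : Fact q.Prime), q ≠ 2 ∧ q ≠ p ∧ Literature.NumberTheory.EllipticCurves.Rank1Residual.Mult W q ∧
        ¬ W.HasSplitMultiplicativeReductionAtPrime q ∧ ¬ p ∣ padicValInt q W.minimalDiscriminantInt) ∧
      (∀ P : (W.baseChange ℚ_[p]).toAffine.Point, p • P = 0 → P = 0)) →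
    (∃ s : ℚ, shaAn W = (s : ℂ) ∧ padicValRat p s ≤ 0) →
    Summit.BirchSwinnertonDyer.Rank1Residual.X11b.P2OpenInputOnTreeAt W p

/-- [crux branch (D) of item 19624 `RamNoErratumDataAtFive`] **REST‴ on the (ram) no-erratum pairs where `#Ш(E)_an`, whenever
rational, has POSITIVE `p`-adic valuation** (granted BSD: the pairs with `Ш(E)[p] ≠ 0`): route p2's open input there — by
`ErratumRoadFiveRest3Exact.lean` the genuinely open content of item 19624 (the lower half `ord_p #Ш(E)_an ≤ ord_p #Ш(E)` where it is
not free). EMPTY below `N < 5·10⁵` (0 of 703 204 REST‴ pairs; K2-wide the only X11b pair with `p ∣ #Ш_an` in Cremona's range,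
`(403280bd1, 5)`, is ¬(ram)); no road in print (erratum road needs a non-split ramified witness; SZ14 Thm. 1.3 is PRE, Locus-only and
`Ш`-trivial). A `Prop` constant; OPEN; nothing asserted.
[cite: Miller2011LMS, Def. 1.1 (the datum `#Ш_an`; nothing asserted)] [cite: Castella2018Erratum, Thm. 1.1 (iii)–(iv) (the excluded clauses)] -/
@[conjecture]
def Rest3ShaDivisibleBranchAtFive : Prop :=
  ∀ (W : WeierstrassCurve ℚ) [W.IsElliptic] [W.IsGloballyMinimal] (p : ℕ) [Fact p.Prime],
    Literature.NumberTheory.EllipticCurves.Rank1Residual.Ram W p →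
    ¬ ((∃ (q : ℕ) (_ : Fact q.Prime), q ≠ 2 ∧ q ≠ p ∧ Literature.NumberTheory.EllipticCurves.Rank1Residual.Mult W q ∧
        ¬ W.HasSplitMultiplicativeReductionAtPrime q ∧ ¬ p ∣ padicValInt q W.minimalDiscriminantInt) ∧
      (∀ P : (W.baseChange ℚ_[p]).toAffine.Point, p • P = 0 → P = 0)) →
    (∀ s : ℚ, shaAn W = (s : ℂ) → 0 < padicValRat p s) →
    Summit.BirchSwinnertonDyer.Rank1Residual.X11b.P2OpenInputOnTreeAt W p

/-! ### §1 The glue: (U) + (D) ⟺ REST‴ (item 19624's text verbatim) -/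

/-- **GLUE — REST‴ (item 19624 `RamNoErratumDataAtFive`, text VERBATIM) from its two `Ш_an`-branches.** Case split on the datum
`∃ s, #Ш(E)_an = s ∧ ord_p s ≤ 0`: if it holds, branch (U); otherwise every rational value of `#Ш(E)_an` has positive valuation and
branch (D) applies. Pure logic; the planner's `--split` glue. [folklore] -/
theorem rest3_of_shaBranches (hU : Rest3ShaUnitBranchAtFive) (hD : Rest3ShaDivisibleBranchAtFive) :
    ∀ (W : WeierstrassCurve ℚ) [W.IsElliptic] [W.IsGloballyMinimal] (p : ℕ) [Fact p.Prime],
      Ram W p →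
      ¬ ((∃ (q : ℕ) (_ : Fact q.Prime), q ≠ 2 ∧ q ≠ p ∧ Mult W q ∧
          ¬ W.HasSplitMultiplicativeReductionAtPrime q ∧ ¬ p ∣ padicValInt q W.minimalDiscriminantInt) ∧
        (∀ P : (W.baseChange ℚ_[p]).toAffine.Point, p • P = 0 → P = 0)) →
      P2OpenInputOnTreeAt W p := by
  intro W _ _ p _ hram hno
  by_cases h : ∃ s : ℚ, shaAn W = (s : ℂ) ∧ padicValRat p s ≤ 0
  · exact hU W p hram hno h
  · refine hD W p hram hno fun s hs ↦ ?_
    by_contra hle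
    exact h ⟨s, hs, not_lt.mp hle⟩

/-- REST‴ ⟹ branch (U) (drop the datum). Bookkeeping. [folklore] -/
theorem rest3ShaUnitBranchAtFive_of_rest3
    (h : ∀ (W : WeierstrassCurve ℚ) [W.IsElliptic] [W.IsGloballyMinimal] (p : ℕ) [Fact p.Prime],
      Ram W p →
      ¬ ((∃ (q : ℕ) (_ : Fact q.Prime), q ≠ 2 ∧ q ≠ p ∧ Mult W q ∧
          ¬ W.HasSplitMultiplicativeReductionAtPrime q ∧ ¬ p ∣ padicValInt q W.minimalDiscriminantInt) ∧
        (∀ P : (W.baseChange ℚ_[p]).toAffine.Point, p • P = 0 → P = 0)) →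
      P2OpenInputOnTreeAt W p) :
    Rest3ShaUnitBranchAtFive :=
  fun W _ _ p _ hram hno _ ↦ h W p hram hno

/-- REST‴ ⟹ branch (D) (drop the valuation clause). Bookkeeping. [folklore] -/
theorem rest3ShaDivisibleBranchAtFive_of_rest3
    (h : ∀ (W : WeierstrassCurve ℚ) [W.IsElliptic] [W.IsGloballyMinimal] (p : ℕ) [Fact p.Prime],
      Ram W p →
      ¬ ((∃ (q : ℕ) (_ : Fact q.Prime), q ≠ 2 ∧ q ≠ p ∧ Mult W q ∧
          ¬ W.HasSplitMultiplicativeReductionAtPrime q ∧ ¬ p ∣ padicValInt q W.minimalDiscriminantInt) ∧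
        (∀ P : (W.baseChange ℚ_[p]).toAffine.Point, p • P = 0 → P = 0)) →
      P2OpenInputOnTreeAt W p) :
    Rest3ShaDivisibleBranchAtFive :=
  fun W _ _ p _ hram hno _ ↦ h W p hram hno

/-- **The `Ш_an`-cut is LOSSLESS**: REST‴ (text verbatim) ⟺ (U) ∧ (D). Bookkeeping. [folklore] -/
theorem rest3_iff_shaBranches :
    (∀ (W : WeierstrassCurve ℚ) [W.IsElliptic] [W.IsGloballyMinimal] (p : ℕ) [Fact p.Prime],
      Ram W p →
      ¬ ((∃ (q : ℕ) (_ : Fact q.Prime), q ≠ 2 ∧ q ≠ p ∧ Mult W q ∧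
          ¬ W.HasSplitMultiplicativeReductionAtPrime q ∧ ¬ p ∣ padicValInt q W.minimalDiscriminantInt) ∧
        (∀ P : (W.baseChange ℚ_[p]).toAffine.Point, p • P = 0 → P = 0)) →
      P2OpenInputOnTreeAt W p) ↔
    Rest3ShaUnitBranchAtFive ∧ Rest3ShaDivisibleBranchAtFive :=
  ⟨fun h ↦ ⟨rest3ShaUnitBranchAtFive_of_rest3 h, rest3ShaDivisibleBranchAtFive_of_rest3 h⟩,
    fun h ↦ rest3_of_shaBranches h.1 h.2⟩

/-! ### §2 Branch (U) is a theorem modulo the published facts; REST‴ reduces to branch (D) -/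

/-- **Branch (U) DISCHARGED modulo the published facts**: Gross–Zagier `hGZ`, Kolyvagin `hKo`, Skinner 2016 Thm. C `hSk`, GZK `hGZK`,
modularity `hmod` and JSW17 Thm. 3.3.1-mult `h331` ⟹ `Rest3ShaUnitBranchAtFive` — the `Ш_an` certificate
(`openInputOnTreeAt_of_shaAn_nonpos_of_thm331Mult`, p512402) with the datum now a HYPOTHESIS OF THE BRANCH, so no data binder is left.
CONDITIONAL on the named facts only; nothing booked. [cite: JetchevSkinnerWan2017, Thm. 3.3.1 with §3.5 (3.5.c), §7.4.1]
[cite: Skinner2016PacificMC, Thm. C (§1)] [cite: Miller2011LMS, Def. 1.1] -/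
theorem rest3ShaUnitBranchAtFive_of_thm331Mult
    (h331 : JetchevSkinnerWan2017.thm331_anticyclotomicControl_mult)
    (hGZ : ∀ (N : ℕ) [NeZero N] (W : WeierstrassCurve ℚ) (K : Type) [Field K] [NumberField K],
      gross_zagier N W K)
    (hKo : ∀ (N : ℕ) [NeZero N] (W : WeierstrassCurve ℚ) (K : Type) [Field K] [NumberField K],
      kolyvagin N W K)
    (hSk : Skinner2016.thmC_padicValRat_bsd_rank_zero)
    (hGZK : rank_eq_analyticRank_of_analyticRank_le_one) (hmod : hasEntireLFunction_rat) :
    Rest3ShaUnitBranchAtFive := by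
  intro W _ _ p _ hram _ hdat
  obtain ⟨s, hs, hv⟩ := hdat
  exact openInputOnTreeAt_of_shaAn_nonpos_of_thm331Mult W p h331 hGZ hKo hSk hGZK hmod hram hs hv

/-- **REST‴ (item 19624, text VERBATIM) ⟸ branch (D) + the published facts** — the DOWN glue a route's `closes` may cite (facts =
conjuncts 1, 2, 4, 6, 7 of `PublishedInputsFive` and item 19626): §2 discharges (U), §1 glues. CONDITIONAL; nothing booked.
[cite: JetchevSkinnerWan2017, Thm. 3.3.1, §7.4.1] [cite: Skinner2016PacificMC, Thm. C (§1)] [cite: Castella2018Erratum, Thm. 1.1 (iii)–(iv)] -/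
theorem rest3_of_rest3ShaDivisibleBranch_of_thm331Mult
    (h331 : JetchevSkinnerWan2017.thm331_anticyclotomicControl_mult)
    (hGZ : ∀ (N : ℕ) [NeZero N] (W : WeierstrassCurve ℚ) (K : Type) [Field K] [NumberField K],
      gross_zagier N W K)
    (hKo : ∀ (N : ℕ) [NeZero N] (W : WeierstrassCurve ℚ) (K : Type) [Field K] [NumberField K],
      kolyvagin N W K)
    (hSk : Skinner2016.thmC_padicValRat_bsd_rank_zero)
    (hGZK : rank_eq_analyticRank_of_analyticRank_le_one) (hmod : hasEntireLFunction_rat)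
    (hD : Rest3ShaDivisibleBranchAtFive) :
    ∀ (W : WeierstrassCurve ℚ) [W.IsElliptic] [W.IsGloballyMinimal] (p : ℕ) [Fact p.Prime],
      Ram W p →
      ¬ ((∃ (q : ℕ) (_ : Fact q.Prime), q ≠ 2 ∧ q ≠ p ∧ Mult W q ∧
          ¬ W.HasSplitMultiplicativeReductionAtPrime q ∧ ¬ p ∣ padicValInt q W.minimalDiscriminantInt) ∧
        (∀ P : (W.baseChange ℚ_[p]).toAffine.Point, p • P = 0 → P = 0)) →
      P2OpenInputOnTreeAt W p :=
  rest3_of_shaBranches (rest3ShaUnitBranchAtFive_of_thm331Mult h331 hGZ hKo hSk hGZK hmod) hD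

/-- **Branch (D), X11b-sharp form**: it suffices to give the open input at the pairs where the conclusion is NOT vacuous — `ClassX11b W p`,
`5 ≤ p`, `ρ̄` onto — with a (ram) witness, no erratum datum and positive valuation of every rational value of `#Ш(E)_an`.
Bookkeeping (`p2OpenInputOnTreeAt_of_imp_surj`). [folklore] -/
theorem rest3ShaDivisibleBranchAtFive_of_sharp
    (h : ∀ (W : WeierstrassCurve ℚ) [W.IsElliptic] [W.IsGloballyMinimal] (p : ℕ) [Fact p.Prime],
      ClassX11b W p → 5 ≤ p → Rank1Residual.Surj W p → Rank1Residual.Ram W p →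
      ¬ ((∃ (q : ℕ) (_ : Fact q.Prime), q ≠ 2 ∧ q ≠ p ∧ Rank1Residual.Mult W q ∧
          ¬ W.HasSplitMultiplicativeReductionAtPrime q ∧ ¬ p ∣ padicValInt q W.minimalDiscriminantInt) ∧
        (∀ P : (W.baseChange ℚ_[p]).toAffine.Point, p • P = 0 → P = 0)) →
      (∀ s : ℚ, shaAn W = (s : ℂ) → 0 < padicValRat p s) → P2OpenInputOnTreeAt W p) :
    Rest3ShaDivisibleBranchAtFive :=
  fun W _ _ p _ hram hno hpos ↦ p2OpenInputOnTreeAt_of_imp_surj W p fun hX hp5 hs ↦ h W p hX hp5 hs hram hno hpos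

end Summit.BirchSwinnertonDyer.BirchSwinnertonDyer.Theorems

end
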